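import Summits.QuantumFields.YangMills.Theorems.ColdStartUniversalityLatticeLangevinAutocorrelationLowerBound
import Summits.QuantumFields.YangMills.Theorems.ColdStartUniversalityLatticeLangevinWilsonL2Contraction
import Summits.QuantumFields.YangMills.Theorems.ColdStartUniversalityLatticeLangevinExpMixing
import HarnessLib

/-!
# Route `ColdStartUniversality` (fixed-cut-off `L²(μ_{β'})` package): the SPECTRAL GAP of the reversible SZZ dynamics
# at the Doeblin rate — `‖P_t‖_{L²₀(μ_{β'})} ≤ e^{-ct}` at every coupling

Helper file (seat `ym-line-csu-p1`, g16).  For the SU(2) lattice Langevin (Shen–Zhu–Zhu) dynamics on `SU(2)^E`,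
`E` the edges of `(ℤ/L)³`, at ANY coupling `β'`, with `μ = μ_{β'}` the Wilson measure and `P_t = κ_t` any Markov kernel
family realising the transition laws:

* `exp_mixing_transitionKernel` — the tree's uniform exponential mixing (`exp_mixing_szz`, Harris/Doeblin) read on
  kernels: `|κ_t F(x) - μ(F)| ≤ M · C e^{-ct}` for measurable `|F| ≤ M`, EVERY start `x`; `C, c > 0` depend on `L, β'` only.
* ★ `integral_mul_transition_le_exp_of_mixing` — THE TRANSFER «uniform total-variation rate ⇒ `L²(μ)` rate with
  constant ONE»: if `|κ_t F − μF| ≤ M_F C e^{-ct}` for continuous `F`, then for every continuous CENTRED `F`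
  `⟨F, P_t F⟩_μ ≤ e^{-ct} ‖F‖²_μ`.  Proof: the crude bound `⟨F, P_uF⟩ ≤ M²C e^{-cu}` is upgraded by the tree's dyadic
  log-convexity `‖F‖² (⟨F,P_{u/2^k}F⟩/‖F‖²)^{2^k} ≤ ⟨F,P_uF⟩` (`integral_mul_transition_ge_pow`, from reversibility
  `integral_mul_transition_symm_su2` + Cauchy–Schwarz): with `u = 2^k t`, `(⟨F,P_tF⟩ e^{ct}/‖F‖²)^{2^k} ≤ M²C/‖F‖²`
  for all `k`, so the base is `≤ 1`.  (For reversible Markov processes geometric ergodicity in total variation and an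
  `L²(μ)` spectral gap are equivalent — Roberts–Rosenthal; here the elementary direction with the explicit rate.)
* ★★ `wilson_spectralGap` — hence, with the Doeblin rate `c = c(L, β')` of `exp_mixing_szz`: for every realising
  kernel family, every continuous `F` with `∫ F dμ = 0` and every lattice time `t`,
  `∫ F · κ_t F dμ ≤ e^{-ct} ∫ F² dμ` and `∫ (κ_t F)² dμ ≤ e^{-2ct} ∫ F² dμ`, i.e. `‖P_t‖_{L²₀(μ) → L²₀(μ)} ≤ e^{-ct}`:
  the `L²(μ_{β'})` SPECTRAL GAP of the SZZ generator is at least the Doeblin rate (constant `1`, no prefactor).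
* `integral_sq_transition_sub_le_exp` — variance form for an arbitrary continuous `F`:
  `Var_μ-decay ∫ (κ_t F − μF)² dμ ≤ e^{-2ct} Var_μ(F)`.
* (sequel `…WilsonPoincare`: differentiating the gap at `t = 0⁺` gives the POINCARÉ INEQUALITY `c·Var_μ(F) ≤ 𝓔(F)` for
  the Wilson measure at every `β'`; with g15's lower bound `integral_sq_mul_exp_le_integral_mul_transition` the stationary
  autocorrelations are sandwiched: `‖F‖² e^{-t𝓔(F)/‖F‖²} ≤ ⟨F,P_tF⟩ ≤ ‖F‖² e^{-ct}`.)

THEOREMS ONLY, no definition, no sorry, standard axioms.  HONEST FRAMING: fixed-cut-off plumbing — `c = c(L, β')` is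
Harris' rate at ONE cut-off and is not claimed uniform in anything; this is the `L²(μ_K)` entrance (variational
spectral gap `λ_K ≥ c_K`, Poincaré constant `≤ 1/c_K`) for LINE 7 / LINE 4 arguments, not the K-uniform crux; no rung,
crux or summit statement is proved here; the Yang–Mills mass gap is NOT proved.
-/

set_option autoImplicit false

noncomputable section

namespace Summit.QuantumFields.YangMills.Theorems.ColdStartUniversality

open MeasureTheory ProbabilityTheory Finset Filter Set Topology Metric
open scoped BigOperators NNReal ENNReal
open Literature.Probability.Process Literature.MathematicalPhysics.QuantumFieldTheory
open Literature.MathematicalPhysics.QuantumLattice (fundamentalRep fundamentalLatticeRep continuous_fundamentalRep)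

variable {L : ℕ} [NeZero L]

/-! ## Uniform exponential mixing, kernel form -/

/-- **Uniform exponential mixing on kernels.**  For every torus size `L` and coupling `β'` there are `C, c > 0` such that
for EVERY Markov kernel family `κ` realising the transition laws of the SZZ dynamics, every start `x`, lattice time `t`
and measurable `F` with `|F| ≤ M`: `|∫ F dκ_t x − ∫ F dμ_{β'}| ≤ M · C e^{-ct}` (the tree's `exp_mixing_szz` — Harris'
theorem with the Doeblin minorisation `doeblin_szz` — applied to a solution from `x` on the product Wiener space, whose
time-`t` law is `κ_t x`). [cite: HairerMattingly2011, Theorems 1.2 and 1.3] -/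
theorem exp_mixing_transitionKernel (L : ℕ) [NeZero L] (β' : ℝ) :
    ∃ C c : ℝ, 0 < C ∧ 0 < c ∧
      ∀ (κ : ℝ≥0 → Kernel (GaugeConfig 3 L (Matrix.specialUnitaryGroup (Fin 2) ℂ))
          (GaugeConfig 3 L (Matrix.specialUnitaryGroup (Fin 2) ℂ))) [∀ t, IsMarkovKernel (κ t)],
        (∀ (t : ℝ≥0) (x : GaugeConfig 3 L (Matrix.specialUnitaryGroup (Fin 2) ℂ))
          (Ω : Type) [MeasurableSpace Ω] (P : Measure Ω) [IsProbabilityMeasure P]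
          (W : ℝ≥0 → Ω → (Edge 3 L × NoiseIdx 2 → ℝ)) (hW : IsFlatBrownian W P)
          (U : ℝ≥0 → Ω → GaugeConfig 3 L (Matrix.specialUnitaryGroup (Fin 2) ℂ)),
          (∀ ω, U 0 ω = x) →
          (latticeLangevinDynamics (fundamentalLatticeRep 2) β').IsSolution (fundamentalRep (Fin 2))
            hW.natFiltration P W U →
          κ t x = P.map (U t)) →
        ∀ (x : GaugeConfig 3 L (Matrix.specialUnitaryGroup (Fin 2) ℂ)) (t : ℝ≥0)
          (F : GaugeConfig 3 L (Matrix.specialUnitaryGroup (Fin 2) ℂ) → ℝ), Measurable F →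
          ∀ M : ℝ, (∀ y, |F y| ≤ M) →
          |(∫ y, F y ∂(κ t x)) - ∫ y, F y ∂(wilsonMeasure (d := 3) (L := L) (fundamentalRep (Fin 2)) β')| ≤
            M * (C * Real.exp (-c * t)) := by
  obtain ⟨C, c, hC, hc, h⟩ := exp_mixing_szz_map L β'
  refine ⟨C, c, hC, hc, fun κ _ hreal x t F hF M hM => ?_⟩
  haveI := isProbabilityMeasure_piWiener (Edge 3 L × NoiseIdx 2)
  have hWc := isFlatBrownian_piWiener 3 L (NoiseIdx 2)
  obtain ⟨U, hU0, hU⟩ := solution_from_start hWc β' x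
  rw [hreal t x _ _ _ hWc U hU0 hU]
  -- `0 ≤ M` (the state space is nonempty)
  have hM0 : 0 ≤ M := (abs_nonneg _).trans (hM fun _ => 1)
  rcases hM0.eq_or_lt with hM0' | hMpos
  · -- `M = 0`: `F = 0`
    have hF0 : F = fun _ => 0 := funext fun y => abs_nonpos_iff.1 (hM0' ▸ hM y)
    subst hF0
    simp only [integral_zero, sub_self, abs_zero, ← hM0', zero_mul, le_refl]
  · -- scale to `|F/M| ≤ 1`
    have h1 : ∀ y, |F y / M| ≤ 1 := fun y => by
      rw [abs_div, abs_of_pos hMpos, div_le_one hMpos]; exact hM y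
    have hb := h x t (fun y => F y / M) (hF.div_const M) h1 _ _ _ hWc U hU0 hU
    have e1 : ∫ y, F y / M ∂(Measure.map (U t) (Measure.pi fun _ : Edge 3 L × NoiseIdx 2 => preWienerMeasure)) =
        (∫ y, F y ∂(Measure.map (U t) (Measure.pi fun _ : Edge 3 L × NoiseIdx 2 => preWienerMeasure))) / M :=
      integral_div M _
    have e2 : ∫ y, F y / M ∂(wilsonMeasure (d := 3) (L := L) (fundamentalRep (Fin 2)) β') =
        (∫ y, F y ∂(wilsonMeasure (d := 3) (L := L) (fundamentalRep (Fin 2)) β')) / M := integral_div M _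
    rw [e1, e2, ← sub_div, abs_div, abs_of_pos hMpos, div_le_iff₀ hMpos] at hb
    linarith [hb]

/-! ## From a uniform total-variation rate to the `L²(μ)` rate (log-convexity) -/

/-- ★ **Uniform mixing rate ⇒ spectral gap at the same rate, constant one.**  Let `κ` realise the SZZ transition laws at
`β'` and suppose `|∫ F dκ_u x − ∫ F dμ_{β'}| ≤ M · C e^{-cu}` for all continuous `F` with `|F| ≤ M`, all `x, u`
(`C > 0`).  Then for every continuous `F` with `∫ F dμ_{β'} = 0` and every `t`,
`∫ F · κ_t F dμ_{β'} ≤ e^{-ct} ∫ F² dμ_{β'}`.  The crude consequence `⟨F, P_uF⟩ ≤ M² C e^{-cu}` of the hypothesis is fed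
into the dyadic log-convexity `‖F‖² (⟨F,P_{u/2^k}F⟩/‖F‖²)^{2^k} ≤ ⟨F, P_uF⟩` (`integral_mul_transition_ge_pow`) at
`u = 2^k t`: `(e^{ct}⟨F,P_tF⟩/‖F‖²)^{2^k} ≤ M²C/‖F‖²` for every `k`, whence the base is `≤ 1`.
[cite: RobertsRosenthal1997, Theorem 2.1 (reversible: geometric ergodicity ⇔ L²(π) spectral gap)] -/
theorem integral_mul_transition_le_exp_of_mixing (L : ℕ) [NeZero L] (β' : ℝ)
    (κ : ℝ≥0 → Kernel (GaugeConfig 3 L (Matrix.specialUnitaryGroup (Fin 2) ℂ))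
      (GaugeConfig 3 L (Matrix.specialUnitaryGroup (Fin 2) ℂ))) [∀ t, IsMarkovKernel (κ t)]
    (hreal : ∀ (t : ℝ≥0) (x : GaugeConfig 3 L (Matrix.specialUnitaryGroup (Fin 2) ℂ))
        (Ω : Type) [MeasurableSpace Ω] (P : Measure Ω) [IsProbabilityMeasure P]
        (W : ℝ≥0 → Ω → (Edge 3 L × NoiseIdx 2 → ℝ)) (hW : IsFlatBrownian W P)
        (U : ℝ≥0 → Ω → GaugeConfig 3 L (Matrix.specialUnitaryGroup (Fin 2) ℂ)),
        (∀ ω, U 0 ω = x) →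
        (latticeLangevinDynamics (fundamentalLatticeRep 2) β').IsSolution (fundamentalRep (Fin 2))
          hW.natFiltration P W U →
        κ t x = P.map (U t))
    {C c : ℝ} (hC : 0 < C)
    (hmix : ∀ (x : GaugeConfig 3 L (Matrix.specialUnitaryGroup (Fin 2) ℂ)) (u : ℝ≥0)
        (F : GaugeConfig 3 L (Matrix.specialUnitaryGroup (Fin 2) ℂ) → ℝ), Continuous F →
        ∀ M : ℝ, (∀ y, |F y| ≤ M) →
        |(∫ y, F y ∂(κ u x)) - ∫ y, F y ∂(wilsonMeasure (d := 3) (L := L) (fundamentalRep (Fin 2)) β')| ≤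
          M * (C * Real.exp (-c * u)))
    {F : GaugeConfig 3 L (Matrix.specialUnitaryGroup (Fin 2) ℂ) → ℝ} (hF : Continuous F)
    (hF0 : ∫ x, F x ∂(wilsonMeasure (d := 3) (L := L) (fundamentalRep (Fin 2)) β') = 0) (t : ℝ≥0) :
    ∫ x, F x * (∫ y, F y ∂(κ t x)) ∂(wilsonMeasure (d := 3) (L := L) (fundamentalRep (Fin 2)) β') ≤
      Real.exp (-c * t) * ∫ x, F x * F x ∂(wilsonMeasure (d := 3) (L := L) (fundamentalRep (Fin 2)) β') := by
  classical
  haveI := secondCountableTopology_su2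
  haveI := borelSpace_config L
  set μ : Measure (GaugeConfig 3 L (Matrix.specialUnitaryGroup (Fin 2) ℂ)) :=
    wilsonMeasure (d := 3) (L := L) (fundamentalRep (Fin 2)) β' with hμ
  haveI : IsProbabilityMeasure μ :=
    isProbabilityMeasure_wilsonMeasure (d := 3) (L := L) (fundamentalRep (Fin 2)) (continuous_fundamentalRep (Fin 2)) β'
  set φ : ℝ≥0 → ℝ := fun v => ∫ x, F x * (∫ y, F y ∂(κ v x)) ∂μ with hφ
  set φ₀ : ℝ := ∫ x, F x * F x ∂μ with hφ₀
  obtain ⟨M, hM0, hM⟩ := exists_abs_le_of_continuous hF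
  -- the crude bound `φ u ≤ M² C e^{-cu}`
  have hcrude : ∀ u : ℝ≥0, φ u ≤ M * (M * (C * Real.exp (-c * u))) := by
    intro u
    have hpt : ∀ x, F x * (∫ y, F y ∂(κ u x)) ≤ M * (M * (C * Real.exp (-c * u))) := by
      intro x
      have h1 : |∫ y, F y ∂(κ u x)| ≤ M * (C * Real.exp (-c * u)) := by
        have h := hmix x u F hF M hM
        rwa [hF0, sub_zero] at h
      calc F x * (∫ y, F y ∂(κ u x)) ≤ |F x * (∫ y, F y ∂(κ u x))| := le_abs_self _
        _ = |F x| * |∫ y, F y ∂(κ u x)| := abs_mul _ _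
        _ ≤ M * (M * (C * Real.exp (-c * u))) :=
            mul_le_mul (hM x) h1 (abs_nonneg _) hM0
    have hGc : Continuous fun x => F x * ∫ y, F y ∂(κ u x) :=
      hF.mul (continuous_integral_transitionKernel L β' κ hreal u hF)
    calc φ u ≤ ∫ _x, M * (M * (C * Real.exp (-c * u))) ∂μ :=
          integral_mono (integrable_of_continuous_of_compactSpace hGc μ) (integrable_const _) hpt
      _ = M * (M * (C * Real.exp (-c * u))) := by simp [integral_const]
  -- `κ_0 = δ`: `φ 0 = φ₀`
  have hκ0 : ∀ x, κ 0 x = Measure.dirac x := by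
    intro x
    haveI := isProbabilityMeasure_piWiener (Edge 3 L × NoiseIdx 2)
    have hWc := isFlatBrownian_piWiener 3 L (NoiseIdx 2)
    obtain ⟨U, hU0, hU⟩ := solution_from_start hWc β' x
    rw [hreal 0 x _ _ _ hWc U hU0 hU]
    have hU0' : U 0 = fun _ => x := funext hU0
    rw [hU0', Measure.map_const, measure_univ, one_smul]
  have hφ0 : φ 0 = φ₀ := integral_congr_ae (Eventually.of_forall fun x => by
    show F x * (∫ y, F y ∂(κ 0 x)) = F x * F x
    rw [hκ0 x, integral_dirac])
  have hφ₀nn : 0 ≤ φ₀ := integral_nonneg fun x => mul_self_nonneg (F x)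
  have hexp : 0 < Real.exp (-c * t) := Real.exp_pos _
  -- `φ t ≤ φ 0 = φ₀` (monotonicity)
  have hφt_le : φ t ≤ φ₀ := by
    have h := integral_mul_transition_self_antitone L β' κ hreal 0 t hF
    rw [zero_add] at h
    exact h.trans hφ0.le
  rcases hφ₀nn.eq_or_lt with hz | hpos
  · -- `‖F‖² = 0`
    rw [← hz, mul_zero]
    exact hφt_le.trans hz.symm.le
  -- `‖F‖² > 0`: the dyadic bounds
  by_contra hcon
  have hlt : Real.exp (-c * t) * φ₀ < φ t := not_le.1 hcon
  -- `r := φ t / φ₀ > e^{-ct}`, `q := r e^{ct} > 1`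
  set q : ℝ := φ t / φ₀ * Real.exp (c * t) with hq
  have hq1 : 1 < q := by
    have h1 : Real.exp (-c * t) < φ t / φ₀ := (lt_div_iff₀ hpos).2 hlt
    have h2 : Real.exp (-c * t) * Real.exp (c * t) = 1 := by
      rw [← Real.exp_add]; simp
    calc (1 : ℝ) = Real.exp (-c * t) * Real.exp (c * t) := h2.symm
      _ < φ t / φ₀ * Real.exp (c * t) := mul_lt_mul_of_pos_right h1 (Real.exp_pos _)
  -- `q^{2^k} ≤ A := M² C / φ₀` for all `k`
  set A : ℝ := M * (M * C) / φ₀ with hA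
  have hqk : ∀ k : ℕ, q ^ (2 ^ k) ≤ A := by
    intro k
    have h := integral_mul_transition_ge_pow L β' κ hreal hF hpos k (t * 2 ^ k)
    have hu : t * 2 ^ k / 2 ^ k = t := mul_div_cancel_right₀ t (pow_ne_zero k two_ne_zero)
    rw [hu] at h
    -- `φ₀ (φ t/φ₀)^{2^k} ≤ φ (2^k t) ≤ M² C e^{-c t 2^k}`
    have h2 := h.trans (hcrude (t * 2 ^ k))
    have hexp' : Real.exp (-c * ((t * 2 ^ k : ℝ≥0) : ℝ)) = (Real.exp (c * t) ^ (2 ^ k))⁻¹ := by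
      rw [← Real.exp_nat_mul, ← Real.exp_neg]
      congr 1
      push_cast
      ring
    rw [hexp'] at h2
    have hEpos : 0 < Real.exp (c * t) ^ (2 ^ k) := pow_pos (Real.exp_pos _) _
    rw [hq, mul_pow, hA, le_div_iff₀ hpos]
    have h3 : φ₀ * (φ t / φ₀) ^ 2 ^ k * Real.exp (c * t) ^ 2 ^ k ≤ M * (M * C) :=
      calc φ₀ * (φ t / φ₀) ^ 2 ^ k * Real.exp (c * t) ^ 2 ^ k
          ≤ M * (M * (C * (Real.exp (c * t) ^ 2 ^ k)⁻¹)) * Real.exp (c * t) ^ 2 ^ k :=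
            mul_le_mul_of_nonneg_right h2 hEpos.le
        _ = M * (M * C) := by field_simp
    calc (φ t / φ₀) ^ 2 ^ k * Real.exp (c * t) ^ 2 ^ k * φ₀
        = φ₀ * (φ t / φ₀) ^ 2 ^ k * Real.exp (c * t) ^ 2 ^ k := by ring
      _ ≤ M * (M * C) := h3
  -- but `q^{2^k} ≥ q^k → ∞`
  have hdiv : Tendsto (fun k : ℕ => q ^ k) atTop atTop := tendsto_pow_atTop_atTop_of_one_lt hq1
  obtain ⟨k, hk⟩ := (hdiv.eventually (eventually_gt_atTop A)).exists
  have hmono : q ^ k ≤ q ^ (2 ^ k) := pow_le_pow_right₀ hq1.le (Nat.lt_two_pow_self).le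
  exact absurd ((hk.trans_le hmono).trans_le (hqk k)) (lt_irrefl _)

/-! ## The spectral gap at the Doeblin rate -/

/-- ★★ **The `L²(μ_{β'})` spectral gap of the SZZ dynamics is at least the Doeblin rate.**  For every torus size `L`
and coupling `β'` there is `c > 0` (the rate of `exp_mixing_szz`) such that for EVERY Markov kernel family realising the
transition laws, every continuous `F` with `∫ F dμ_{β'} = 0` and every lattice time `t`:
`∫ F · κ_t F dμ_{β'} ≤ e^{-ct} ∫ F² dμ_{β'}` (autocorrelations), `∫ (κ_t F)² dμ_{β'} ≤ e^{-2ct} ∫ F² dμ_{β'}`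
(`‖P_t F‖_{L²(μ)} ≤ e^{-ct} ‖F‖_{L²(μ)}` on mean-zero `F`, constant ONE), and for an arbitrary continuous `F` the variance
decay `∫ (κ_t F − μF)² dμ_{β'} ≤ e^{-2ct} ∫ (F − μF)² dμ_{β'}`.
[cite: RobertsRosenthal1997, Theorem 2.1] [cite: ShenZhuZhu2022, §3 (the μ-symmetric semigroup P_t^L, p. 13)] -/
theorem wilson_spectralGap (L : ℕ) [NeZero L] (β' : ℝ) :
    ∃ c : ℝ, 0 < c ∧
      ∀ (κ : ℝ≥0 → Kernel (GaugeConfig 3 L (Matrix.specialUnitaryGroup (Fin 2) ℂ))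
          (GaugeConfig 3 L (Matrix.specialUnitaryGroup (Fin 2) ℂ))) [∀ t, IsMarkovKernel (κ t)],
        (∀ (t : ℝ≥0) (x : GaugeConfig 3 L (Matrix.specialUnitaryGroup (Fin 2) ℂ))
          (Ω : Type) [MeasurableSpace Ω] (P : Measure Ω) [IsProbabilityMeasure P]
          (W : ℝ≥0 → Ω → (Edge 3 L × NoiseIdx 2 → ℝ)) (hW : IsFlatBrownian W P)
          (U : ℝ≥0 → Ω → GaugeConfig 3 L (Matrix.specialUnitaryGroup (Fin 2) ℂ)),
          (∀ ω, U 0 ω = x) →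
          (latticeLangevinDynamics (fundamentalLatticeRep 2) β').IsSolution (fundamentalRep (Fin 2))
            hW.natFiltration P W U →
          κ t x = P.map (U t)) →
        ∀ (F : GaugeConfig 3 L (Matrix.specialUnitaryGroup (Fin 2) ℂ) → ℝ), Continuous F → ∀ t : ℝ≥0,
          (∫ x, F x ∂(wilsonMeasure (d := 3) (L := L) (fundamentalRep (Fin 2)) β') = 0 →
            ∫ x, F x * (∫ y, F y ∂(κ t x)) ∂(wilsonMeasure (d := 3) (L := L) (fundamentalRep (Fin 2)) β') ≤
              Real.exp (-c * t) * ∫ x, F x * F x ∂(wilsonMeasure (d := 3) (L := L) (fundamentalRep (Fin 2)) β')) ∧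
          (∫ x, F x ∂(wilsonMeasure (d := 3) (L := L) (fundamentalRep (Fin 2)) β') = 0 →
            ∫ x, (∫ y, F y ∂(κ t x)) ^ 2 ∂(wilsonMeasure (d := 3) (L := L) (fundamentalRep (Fin 2)) β') ≤
              Real.exp (-2 * c * t) * ∫ x, F x * F x ∂(wilsonMeasure (d := 3) (L := L) (fundamentalRep (Fin 2)) β')) ∧
          (∫ x, ((∫ y, F y ∂(κ t x)) - ∫ z, F z ∂(wilsonMeasure (d := 3) (L := L) (fundamentalRep (Fin 2)) β')) ^ 2
              ∂(wilsonMeasure (d := 3) (L := L) (fundamentalRep (Fin 2)) β') ≤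
            Real.exp (-2 * c * t) *
              ∫ x, (F x - ∫ z, F z ∂(wilsonMeasure (d := 3) (L := L) (fundamentalRep (Fin 2)) β')) ^ 2
                ∂(wilsonMeasure (d := 3) (L := L) (fundamentalRep (Fin 2)) β')) := by
  classical
  haveI := secondCountableTopology_su2
  haveI := borelSpace_config L
  haveI : IsProbabilityMeasure (wilsonMeasure (d := 3) (L := L) (fundamentalRep (Fin 2)) β') :=
    isProbabilityMeasure_wilsonMeasure (d := 3) (L := L) (fundamentalRep (Fin 2)) (continuous_fundamentalRep (Fin 2)) β'
  obtain ⟨C, c, hC, hc, hmix⟩ := exp_mixing_transitionKernel L β'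
  refine ⟨c, hc, fun κ _ hreal => ?_⟩
  set μ : Measure (GaugeConfig 3 L (Matrix.specialUnitaryGroup (Fin 2) ℂ)) :=
    wilsonMeasure (d := 3) (L := L) (fundamentalRep (Fin 2)) β' with hμ
  have hmix' : ∀ (x : GaugeConfig 3 L (Matrix.specialUnitaryGroup (Fin 2) ℂ)) (u : ℝ≥0)
      (G : GaugeConfig 3 L (Matrix.specialUnitaryGroup (Fin 2) ℂ) → ℝ), Continuous G →
      ∀ M : ℝ, (∀ y, |G y| ≤ M) → |(∫ y, G y ∂(κ u x)) - ∫ y, G y ∂μ| ≤ M * (C * Real.exp (-c * u)) :=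
    fun x u G hG M hM => hmix κ hreal x u G hG.measurable M hM
  -- (i) autocorrelations and (ii) `L²`-contraction for centred continuous `G`
  have hgap : ∀ {G : GaugeConfig 3 L (Matrix.specialUnitaryGroup (Fin 2) ℂ) → ℝ}, Continuous G →
      ∫ x, G x ∂μ = 0 → ∀ u : ℝ≥0,
        ∫ x, G x * (∫ y, G y ∂(κ u x)) ∂μ ≤ Real.exp (-c * u) * ∫ x, G x * G x ∂μ :=
    fun hG hG0 u => integral_mul_transition_le_exp_of_mixing L β' κ hreal hC hmix' hG hG0 u
  have hL2 : ∀ {G : GaugeConfig 3 L (Matrix.specialUnitaryGroup (Fin 2) ℂ) → ℝ}, Continuous G →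
      ∫ x, G x ∂μ = 0 → ∀ u : ℝ≥0,
        ∫ x, (∫ y, G y ∂(κ u x)) ^ 2 ∂μ ≤ Real.exp (-2 * c * u) * ∫ x, G x * G x ∂μ := by
    intro G hG hG0 u
    rw [← integral_mul_transition_self_eq_sq L β' κ hreal u hG]
    have h := hgap hG hG0 (u + u)
    have he : Real.exp (-c * ((u + u : ℝ≥0) : ℝ)) = Real.exp (-2 * c * u) := by
      congr 1; push_cast; ring
    rwa [he] at h
  intro F hF t
  refine ⟨fun hF0 => hgap hF hF0 t, fun hF0 => hL2 hF hF0 t, ?_⟩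
  -- (iii) variance decay: centre `F`
  set m : ℝ := ∫ z, F z ∂μ with hm
  have hGc : Continuous fun x => F x - m := hF.sub continuous_const
  have hFi : ∀ (ν : Measure (GaugeConfig 3 L (Matrix.specialUnitaryGroup (Fin 2) ℂ))) [IsProbabilityMeasure ν],
      Integrable F ν := fun ν _ => integrable_of_continuous_of_compactSpace hF ν
  have hG0 : ∫ x, (F x - m) ∂μ = 0 := by
    rw [integral_sub (hFi μ) (integrable_const m)]
    simp [hm]
  have hGκ : ∀ x, ∫ y, (F y - m) ∂(κ t x) = (∫ y, F y ∂(κ t x)) - m := by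
    intro x
    rw [integral_sub (hFi _) (integrable_const m)]
    simp
  have h := hL2 hGc hG0 t
  simp_rw [hGκ, ← sq] at h
  exact h

end Summit.QuantumFields.YangMills.Theorems.ColdStartUniversality

end
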